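import Literature.NumberTheory.GaloisRepresentations.IdeleTruncatedSRelativeLayers
import Literature.NumberTheory.GaloisRepresentations.IdeleTruncatedSLocalInjectivity
import Literature.Algebra.Homology.DiscreteRepLayerInflationPullback
import Literature.Algebra.Homology.DiscreteRepLayerBoundary
import HarnessLib

/-!
# [P2-mono], the local-global step at `H²(U, Ī_S)`, I: the conjugated local pull-back of an inflated class IS an inflated
# finite-level class — the finite-level local datum `locLayerClass` (Harari Prop. 17.25 / Milne I Lemma 4.13 at `r = 2`)

Topic `NumberTheory/GaloisRepresentations`; namespace `Literature.NumberTheory.GaloisRepresentations.IdeleReadout`.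
Definitions with bodies (the finite-level local data `locConjHom`, `locLayerSubgroup`, **`locLayerClass`**) and one theorem;
NO named fact, no `sorry`, no instance, no notation; number fields in `Type`.  First file of P2-e/f of the [P2-mono] plan
`P2-MONO-SCOPING-w3g18-v2.md` (lane «PT-Ш-S-TC» of crux `stmt-BirchSwinnertonDyer-19032`, cell bsd-eis; LEAD bsd-line-x1-p1 g11),
consuming P2-a (bsd-eis -w3 g18 `IdeleTruncatedSRelativeLayers`: every `y ∈ Ext²_{C_U}(ℤ, Res_U Ī_S)` is `relInflGIS c`,
`c ∈ H²(H_E, Res_{H_E} J_{E,S})`), P2-d (-w7 g13 `DiscreteRepLayerInflationPullback`: `φ^* ∘ Inf_V = Inf_{φ⁻¹V} ∘ Hⁿ(φ̄, ι)`),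
door-c4 `inflG_map`, and -w4 g20's local family (E2b `conjHom`/`conjCoeff`/`dcRep`, E4c `decompMapPlaceS`/`locQ`/`OverS`).
It FIXES THE INTERFACE with the finite-level analysis P2-b (bsd-eis -w8 g13 `IdeleTruncatedSFiniteComponents`, which imports
this file): the datum `locLayerClass`.

* §1 the finite-level local data at `(w, t)` (`w ∣ S ∪ ∞`, `t ∈ U\G_S/φ_w(Γ_{K_w})`, representative `s_t = dcRep`):
  `locConjHom` (`ψ_{w,t} = conjHom φ_w U s_t : V_w → U`, `V_w = φ_w⁻¹U`), `locLayerSubgroup` (`N_{w,t} = ψ_{w,t}⁻¹(V̄_E ∩ U) ≤ V_w`) and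
  **`locLayerClass … c ∈ Hⁿ(V_w ⧸ N_{w,t}, (Res_{V_w} K̄_wˣ)^{N_{w,t}})`** = `Hⁿ(id, (conjCoeff)^{N_{w,t}}) (Hⁿ(ψ̄_{w,t}, comapLayerHom)
  ((relLayerISCohomologyIso)⁻¹ c))` (`conjCoeff`: `b ↦ π_w(s_t⁻¹ • b)`).
* §2 **`locComponent_relInflGIS_eq_inflG_locLayerClass`**: the `(w,t)`-component of `relInflGIS c` (verbatim sub-term of -w4's
  [P2-mono] binder, E4c/E4e) `=` `inflG N_{w,t} (Res_{V_w} K̄_wˣ) 2 (locLayerClass … c)`.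

The sequel `IdeleTruncatedSLocalInjectivityTwo` assembles [P2-mono] from P2-b and the injectivity of the local inflations
(-w4 g21 `LocalUnitsInflationTwoInjective`).  HONEST FRAMING: layer bookkeeping; no case of Poitou–Tate duality and nothing
about BSD is proved here.  AI formalisation, established only by the kernel check.

## References
* D. Harari, *Galois Cohomology and Class Field Theory*, Universitext (2020), §17.5 Lemma 17.23, Prop. 17.25; §4.3 (2)–(3).
  [Harari2020]
* J. S. Milne, *Arithmetic Duality Theorems*, 2nd ed. (2006), I Lemma 4.13, I Thm. 4.10 (a) (proof, p. 58). [MilneADT2006]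
* J.-P. Serre, *Galois Cohomology* (1997), I §2.2 Prop. 8, §2.4. [SerreGaloisCohomology1997]
-/

noncomputable section

open NumberField IsDedekindDomain Field CategoryTheory CategoryTheory.Limits CategoryTheory.Abelian
open Literature.Algebra.Homology Literature.Algebra.Homology.DiscreteRep
open scoped Classical

namespace Literature.NumberTheory.GaloisRepresentations

namespace IdeleReadout

open IdeleClassBar DiscreteGaloisModule
open Literature.NumberTheory.GaloisRepresentations.LocalWeilDatum (galFixing)

variable (K : Type) [Field K] [NumberField K] (S : Finset (HeightOneSpectrum (𝓞 K)))
  (U : Subgroup (GaloisGroupUnramifiedOutside K (↑S : Set (HeightOneSpectrum (𝓞 K))))) [hUn : U.Normal]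

/-! ## §1 The finite-level local data at `(w, t)` -/

section Data

variable (E : GalLayer K) (w : OverS K S) (t : DoubleCosets (decompMapPlaceS K S w.1) U)

/-- **`ψ_{w,t} = conjHom φ_w U s_t : V_w = φ_w⁻¹U →* U`**, `v ↦ s_t φ_w(v) s_t⁻¹`. [cite: Harari2020, §17.5 Lemma 17.23] -/
abbrev locConjHom : ↥(U.comap (decompMapPlaceS K S w.1)) →* ↥U :=
  conjHom (decompMapPlaceS K S w.1) U (dcRep (decompMapPlaceS K S w.1) U t)

/-- `ψ_{w,t}` is continuous. [cite: Harari2020, §17.5 Lemma 17.23] -/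
theorem continuous_locConjHom : Continuous (locConjHom K S U w t) :=
  continuous_conjHom (decompMapPlaceS K S w.1) (continuous_decompMapPlaceS K S w.1) U (dcRep (decompMapPlaceS K S w.1) U t)

/-- **`N_{w,t} = ψ_{w,t}⁻¹(V̄_E ∩ U)`**, an open normal subgroup of `V_w`. [cite: SerreGaloisCohomology1997, I §2.4] -/
abbrev locLayerSubgroup : OpenNormalSubgroup ↥(U.comap (decompMapPlaceS K S w.1)) :=
  comapOpenNormalSubgroup (locConjHom K S U w t) (continuous_locConjHom K S U w t)
    (traceOpenNormalSubgroup U (layerSubgroupS S E))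

variable {E}
variable (hE : ramificationSubgroup K (↑S : Set (HeightOneSpectrum (𝓞 K))) ≤ galFixing K E.1)
  (hEU : (layerSubgroupS S E : Subgroup (GaloisGroupUnramifiedOutside K (↑S : Set (HeightOneSpectrum (𝓞 K))))) ≤ U)

/-- **The finite-level local datum `c'_{w,t} ∈ H²(V_w ⧸ N_{w,t}, (Res_{V_w} K̄_wˣ)^{N_{w,t}})`** of a class
`c ∈ Hⁿ(H_E, Res_{H_E} J_{E,S})`: transport `c` to the relative layer `(Res_U Ī_S)^{V̄_E ∩ U}` (P2-a's
`relLayerISCohomologyIso⁻¹`) and apply Mathlib's `groupCohomology.map` along the pair `(ψ̄_{w,t}, comapLayerHom)` (-w7) and then along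
`(id, conjCoeff^{N_{w,t}})` (the layer of -w4's conjugated coefficient map `b ↦ π_w(s_t⁻¹ • b)`).
The interface with the finite-level analysis (P2-b). [cite: Harari2020, §17.5 Lemma 17.23, Prop. 17.25]
[cite: SerreGaloisCohomology1997, I §2.2 Proposition 8] -/
def locLayerClass (n : ℕ)
    (c : groupCohomology (haveI := E.numberField;
      Rep.res (subgroupImageS S hE U).subtype (IdeleHerbrand.truncRep K E.1 S)) n) :
    groupCohomology ((invariantsQuotFunctor ℤ
      (locLayerSubgroup K S U E w t : Subgroup ↥(U.comap (decompMapPlaceS K S w.1)))).obj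
        ((resD ℤ (U.comap (decompMapPlaceS K S w.1))).obj (unitsD (Place.Completion w.1)))) n :=
  (groupCohomology.map (MonoidHom.id _)
      ((invariantsQuotFunctor ℤ
        (locLayerSubgroup K S U E w t : Subgroup ↥(U.comap (decompMapPlaceS K S w.1)))).map
        (conjCoeff (decompMapPlaceS K S w.1) (continuous_decompMapPlaceS K S w.1) U (truncIdeleBarD K S)
          (unitsD (Place.Completion w.1)) (locQ K S w) (dcRep (decompMapPlaceS K S w.1) U t) (k := ℤ))) n).hom
    (groupCohomology.map
      (quotComapMap (locConjHom K S U w t) (continuous_locConjHom K S U w t)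
        (traceOpenNormalSubgroup U (layerSubgroupS S E)))
      (comapLayerHom (locConjHom K S U w t) (continuous_locConjHom K S U w t)
        (traceOpenNormalSubgroup U (layerSubgroupS S E)) ((resD ℤ U).obj (truncIdeleBarD K S))) n
      ((relLayerISCohomologyIso S U hE hEU n).inv c))

end Data

/-! ## §2 The `(w,t)`-component of an inflated class is an inflated finite-level class -/

section Component

variable {E : GalLayer K}
  (hE : ramificationSubgroup K (↑S : Set (HeightOneSpectrum (𝓞 K))) ≤ galFixing K E.1)
  (hEU : (layerSubgroupS S E : Subgroup (GaloisGroupUnramifiedOutside K (↑S : Set (HeightOneSpectrum (𝓞 K))))) ≤ U)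
  (w : OverS K S) (t : DoubleCosets (decompMapPlaceS K S w.1) U)

/-- **The `(w,t)`-component of `relInflGIS c` is the inflation, from the layer `N_{w,t}` of `V_w`, of the finite-level
datum `locLayerClass … c`.** [cite: SerreGaloisCohomology1997, I §2.2 Proposition 8, §2.4][cite: Harari2020, §4.3 (2)–(3), §17.5 Lemma 17.23] -/
theorem locComponent_relInflGIS_eq_inflG_locLayerClass
    (c : groupCohomology (haveI := E.numberField;
      Rep.res (subgroupImageS S hE U).subtype (IdeleHerbrand.truncRep K E.1 S)) 2) :
    ((relInflGIS S U hE hEU 2 c).mapExactFunctor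
        (resDHom ℤ (conjHom (decompMapPlaceS K S w.1) U (dcRep (decompMapPlaceS K S w.1) U t))
          (continuous_conjHom (decompMapPlaceS K S w.1) (continuous_decompMapPlaceS K S w.1) U
            (dcRep (decompMapPlaceS K S w.1) U t)))).comp
      (Ext.mk₀ (conjCoeff (decompMapPlaceS K S w.1) (continuous_decompMapPlaceS K S w.1) U
        (truncIdeleBarD K S) (unitsD (Place.Completion w.1)) (locQ K S w) (dcRep (decompMapPlaceS K S w.1) U t)
        (k := ℤ))) (add_zero 2) =
    LayerColimit.inflG (locLayerSubgroup K S U E w t)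
      ((resD ℤ (U.comap (decompMapPlaceS K S w.1))).obj (unitsD (Place.Completion w.1))) 2
      (locLayerClass K S U w t hE hEU 2 c) := by
  have h1 := LayerColimit.mapExactFunctor_resDHom_inflG (locConjHom K S U w t) (continuous_locConjHom K S U w t)
    (traceOpenNormalSubgroup U (layerSubgroupS S E)) ((resD ℤ U).obj (truncIdeleBarD K S)) 2
    ((relLayerISCohomologyIso S U hE hEU 2).inv c)
  have h2 := LayerColimit.inflG_map (locLayerSubgroup K S U E w t)
    (conjCoeff (decompMapPlaceS K S w.1) (continuous_decompMapPlaceS K S w.1) U (truncIdeleBarD K S)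
      (unitsD (Place.Completion w.1)) (locQ K S w) (dcRep (decompMapPlaceS K S w.1) U t) (k := ℤ)) 2
    (groupCohomology.map
      (quotComapMap (locConjHom K S U w t) (continuous_locConjHom K S U w t)
        (traceOpenNormalSubgroup U (layerSubgroupS S E)))
      (comapLayerHom (locConjHom K S U w t) (continuous_locConjHom K S U w t)
        (traceOpenNormalSubgroup U (layerSubgroupS S E)) ((resD ℤ U).obj (truncIdeleBarD K S))) 2
      ((relLayerISCohomologyIso S U hE hEU 2).inv c))
  rw [relInflGIS_apply, h1]
  unfold locLayerClass
  exact h2.symm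

end Component

end IdeleReadout

end Literature.NumberTheory.GaloisRepresentations

end
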